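import Summits.QuantumFields.BalabanUV.Beta.CovariantTowerDecay

/-!
# Beta / MultiscaleConjError — THE SITEWISE CONJUGATION-ERROR BUDGET OF THE MULTI-REGION OPERATOR (node (w2) of the O.2
# skeleton §8.5): for pv21's `levelOp = Δ_U + Σ_j a_j·G_jᵀG_j` with GENERAL data and a site weight `φ` with BONDWISE steps
# `|φ(b₊) − φ(b₋)| ≤ θ_b` and BLOCKWISE oscillations `≤ Θ_j(β)`, the Combes–Thomas conjugation error obeys
# `ERR_φ(levelOp; v) ≥ −[Σ_b ½c_b²(e^{θ_b} − 1)(|v(b₋)|² + |v(b₊)|²) + Σ_j a_j Σ_β w_{jβ}²(e^{Θ_j(β)} − 1)·n_{jβ}·‖v‖²_β]` —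
# the LOCAL (scale-adapted) form of gen-4's `conjErr_towerOp_ge` (one global θ, one global κ_k), i.e. exactly the hypothesis
# shape of the row owner's site-local Combes–Thomas END `MultiscaleCombesThomasBudget.norm_cmat_inv_apply_le_local` (p228368)
# once combined with the sitewise coercivity of `MultiscaleCoercive`∕`MultiscaleCoerciveCover`
# (unit `b2b-balaban-beta-d4-p2`, GEN 7, MODEL crew; claim «MULTISCALE-POINCARE-MODEL» journal l.16779∕l.18140, part (J))

HONEST FRAMING: discharging `BetaPertH` makes Bałaban's UV stability UNCONDITIONAL — NOT the continuum limit, NOT the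
Clay problem.  HONEST DEPENDENCY (verbatim): «continuum YM on T⁴ ⇐ BetaPertH ∧ nine spine estimates (0/9 proved);
BetaPertH ⇐ (D1) ∧ (D4) ∧ CAP+tail; G-an2-4 gates asym, D1 and NE2/3/4.»  THIS MODULE DISCHARGES NOTHING of `BetaPertH`,
asserts NOTHING printed and cites nothing as a fact (ABSOLUTE RULE): [folklore] Combes–Thomas bookkeeping about the pv21
component MODEL (`B9Thm37Glue.covD`, `B9Thm37GlueTorusCovComp.gMean`, `B9Thm37GlueTorusCovLevels.levelOp`; the weight `φ` and
the budgets `θ_b`, `Θ`, `w`, `n` are DATA).  SHAPES located at [B9] = `Balaban1985BackgroundPropagators` (3.24) p. 394, Thm 3.1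
(3.42) p. 397 (decay `e^{−δ₀d(y,y′)}` in the scale-adapted distance with local prefactors); [B6] = `Balaban1984PropagatorsII`
(2.46) p. 231 (the distance `d(y,y′)`).  NOT the decay theorem itself (that is the owner's engine + this budget + (C)∕(I), the
instance = successor node (w2′)); no Dirichlet holes; nothing of Bałaban's own operators.  No class change on row D4
(critical-path width 0; D4 DISCHARGE NO DATE); NOT BetaPertH, NOT continuum, NOT Clay, NOT summit progress.

CONTENT (kernel, 0 sorry).  §1 **`dPart_ge_local`** — the ∇_U-part with a BONDWISE step budget `θ_b`:
`≥ −Σ_b ½c_b²(e^{θ_b} − 1)(F(b₋) + F(b₊))`, `F(x) = Σ_k v(x,k)²`.  §2 **`qPart_gMean_ge_local`** — the G-part of ONE level with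
BLOCKWISE budgets (oscillation `Θ(β)`, weight bound `w(β)`, size `n(β)`): `≥ −Σ_β w(β)²(e^{Θ(β)} − 1)n(β)·Σ_{x∈β}F(x)`.
§3 **`conjErr_levelOp_ge_local`** — the assembly for `levelOp` (any finite level family), and the CONJUGATED-FORM identity
`conjForm_eq` (`Σ_p e^{φ}v·A(e^{−φ}v) = ⟨v,Av⟩ + ERR_φ(A;v)`, the left side being the owner's hypothesis shape).
§4 (v1.1, GEN 8, claim «MULTISCALE-DECAY-MODEL» l.18614 part (J′)) **`dPart_ge_local_cosh`**, **`conjErr_levelOp_ge_local_cosh`** —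
the SECOND-ORDER bond budget `c_b²(cosh θ_b − 1)` (§1's `(e^{θ_b} − 1)/2` is first order in `θ_b`, hence NOT level-free for the
scale-adapted step `θ_b = κ/n`; the cosh form costs `≍ c²κ²/n²`, the local scale of the coercivity).
-/

namespace Summit.QuantumFields.BalabanUV.Beta.MultiscaleConjError

open Finset Function
open Literature.MathematicalPhysics.QuantumFieldTheory.Balaban1983to89
open B9Thm37Glue B9Thm37GlueTorusCovComp B9Thm37GlueTorusCovLevels B9Thm37GlueTorusCovLevelsPoinc
open B9Thm37GlueTorusCovCT (expW expW_apply conjErr bond_term neg_mul_mul_ge exp_add_exp_neg_sub_two_le_of_abs_le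
  sum_sq_Rm_apply)
open Literature.MathematicalPhysics.QuantumFieldTheory.Balaban1983to89.Beta.CombesThomasForm (abs_exp_sub_one_le)
open Summit.QuantumFields.BalabanUV.Beta.CovariantTowerDecay (gtrT gMean_eq_sum_gtrT gMean_expW bilin_levelOp)

noncomputable section

/-! ## §1 The ∇_U-part with a bondwise step budget -/

section DPart

variable {St Bd Cp : Type} [Fintype St] [DecidableEq St] [Fintype Bd] [Fintype Cp] [DecidableEq Cp]
  {src tgt : Bd → St} (c : Bd → ℝ) (Rm : Bd → Cp → Cp → ℝ)

/-- The site energy `F(x) = Σ_k v(x,k)²`. [folklore] -/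
def siteSq (v : St × Cp → ℝ) (x : St) : ℝ := ∑ k, v (x, k) ^ 2

omit [Fintype St] [DecidableEq St] [Fintype Bd] [DecidableEq Cp] in
/-- [folklore] -/
theorem siteSq_nonneg (v : St × Cp → ℝ) (x : St) : 0 ≤ siteSq v x := sum_nonneg fun _ _ => sq_nonneg _

omit [Fintype St] [DecidableEq St] in
/-- **The ∇_U-part of the conjugation error with a BONDWISE step budget** (isometric bond matrices; `|φ(b₊) − φ(b₋)| ≤ θ_b`):
`Σ_q (∇_U e^{φ}v)(q)(∇_U e^{−φ}v)(q) − Σ_q ((∇_U v)(q))² ≥ −Σ_b ½·c_b²·(e^{θ_b} − 1)·(F(b₊) + F(b₋))`.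
[cite: Balaban1985BackgroundPropagators, Thm 3.1 (3.42) p.397] -/
theorem dPart_ge_local (hRm : ∀ b i j, ∑ k, Rm b k i * Rm b k j = if i = j then (1 : ℝ) else 0)
    (φ : St → ℝ) (θ : Bd → ℝ) (hφ : ∀ b, |φ (tgt b) - φ (src b)| ≤ θ b) (v : St × Cp → ℝ) :
    -(∑ b, c b ^ 2 * (Real.exp (θ b) - 1) / 2 * (siteSq v (tgt b) + siteSq v (src b))) ≤
      ∑ q, covD src tgt c Rm (expW φ v) q * covD src tgt c Rm (expW (fun x => -φ x) v) q -
        ∑ q, covD src tgt c Rm v q ^ 2 := by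
  have hch : ∀ t : ℝ, 0 ≤ Real.exp t + Real.exp (-t) - 2 := fun t => by
    have h := Real.one_le_cosh t
    rw [Real.cosh_eq] at h
    linarith
  -- the termwise majorant
  set tb : Bd × Cp → ℝ := fun q => -(c q.1 ^ 2 * (Real.exp (θ q.1) - 1) *
    (((∑ j, Rm q.1 q.2 j * v (tgt q.1, j)) ^ 2 + v (src q.1, q.2) ^ 2) / 2)) with htb
  have hterm : ∀ q : Bd × Cp, tb q ≤
      covD src tgt c Rm (expW φ v) q * covD src tgt c Rm (expW (fun x => -φ x) v) q - covD src tgt c Rm v q ^ 2 := by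
    intro q
    rw [htb, bond_term]
    refine neg_mul_mul_ge (mul_nonneg (sq_nonneg _) (hch _)) ?_
    exact mul_le_mul_of_nonneg_left (exp_add_exp_neg_sub_two_le_of_abs_le (hφ q.1)) (sq_nonneg _)
  -- sum over the components of each bond: isometry of Rm
  have hbond : ∀ b : Bd, ∑ k, tb (b, k) = -(c b ^ 2 * (Real.exp (θ b) - 1) / 2 * (siteSq v (tgt b) + siteSq v (src b))) := by
    intro b
    have e : ∀ k, tb (b, k) =
        -(c b ^ 2 * (Real.exp (θ b) - 1) / 2) * ((∑ j, Rm b k j * v (tgt b, j)) ^ 2 + v (src b, k) ^ 2) := fun k => by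
      rw [htb]; ring
    calc ∑ k, tb (b, k) = -(c b ^ 2 * (Real.exp (θ b) - 1) / 2) *
          ∑ k, ((∑ j, Rm b k j * v (tgt b, j)) ^ 2 + v (src b, k) ^ 2) := by
          rw [Finset.mul_sum]
          exact Finset.sum_congr rfl fun k _ => e k
      _ = -(c b ^ 2 * (Real.exp (θ b) - 1) / 2 * (siteSq v (tgt b) + siteSq v (src b))) := by
          rw [Finset.sum_add_distrib, sum_sq_Rm_apply Rm hRm b (fun j => v (tgt b, j))]
          unfold siteSq
          ring
  have htot : ∑ q : Bd × Cp, tb q = -(∑ b, c b ^ 2 * (Real.exp (θ b) - 1) / 2 * (siteSq v (tgt b) + siteSq v (src b))) := by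
    rw [Fintype.sum_prod_type, ← Finset.sum_neg_distrib]
    exact Finset.sum_congr rfl fun b _ => hbond b
  rw [← htot, ← Finset.sum_sub_distrib]
  exact Finset.sum_le_sum fun q _ => hterm q

end DPart

/-! ## §2 The G-part of one level with blockwise budgets -/

section QPart

variable {St B Cp : Type} [Fintype St] [Fintype B] [DecidableEq B] [Fintype Cp] [DecidableEq Cp]

omit [Fintype St] in
/-- Sitewise isometry: `Σ_i g(x)_i² = F(x)`. [folklore] -/
theorem sum_sq_gtrT_eq {T : St → Cp → Cp → ℝ} (hT : ∀ x i i', ∑ k, T x k i * T x k i' = if i = i' then (1 : ℝ) else 0)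
    (v : St × Cp → ℝ) (x : St) : ∑ i, gtrT T v x i ^ 2 = siteSq v x :=
  sum_sq_orth_apply (hT x) (fun j => v (x, j))

/-- **The G-part of the conjugation error for ONE level with BLOCKWISE budgets**: isometric site transports, `|W(x)| ≤ w(blk x)`,
blocks of `≤ n(β)` sites, oscillation of `φ` over block `β` at most `Θ(β) ≥ 0`:
`Σ_q G(e^{φ}v)(q)·G(e^{−φ}v)(q) − Σ_q (Gv)(q)² ≥ −Σ_β w(β)²·(e^{Θ(β)} − 1)·n(β)·Σ_{x∈β} F(x)`.
[cite: Balaban1985BackgroundPropagators, (3.24) p.394 + Thm 3.1 (3.42) p.397] -/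
theorem qPart_gMean_ge_local (blk : St → B) {W : St → ℝ} (wB : B → ℝ) (hW : ∀ x, |W x| ≤ wB (blk x))
    {T : St → Cp → Cp → ℝ} (hT : ∀ x i i', ∑ k, T x k i * T x k i' = if i = i' then (1 : ℝ) else 0)
    (nB : B → ℕ) (hn : ∀ β, (univ.filter fun x => blk x = β).card ≤ nB β) (Θ : B → ℝ) (hΘ : ∀ β, 0 ≤ Θ β)
    (φ : St → ℝ) (hosc : ∀ x x', blk x = blk x' → |φ x - φ x'| ≤ Θ (blk x)) (v : St × Cp → ℝ) :
    -(∑ β, wB β ^ 2 * (Real.exp (Θ β) - 1) * nB β * ∑ x ∈ univ.filter (fun x => blk x = β), siteSq v x) ≤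
      ∑ q, gMean blk W T (expW φ v) q * gMean blk W T (expW (fun x => -φ x) v) q - ∑ q, gMean blk W T v q ^ 2 := by
  -- the block energies per component
  set G : B → Cp → ℝ := fun β i => ∑ x ∈ univ.filter (fun x => blk x = β), gtrT T v x i ^ 2 with hG
  have hG0 : ∀ β i, 0 ≤ G β i := fun β i => Finset.sum_nonneg fun x _ => sq_nonneg _
  have hGsum : ∀ β, ∑ i, G β i = ∑ x ∈ univ.filter (fun x => blk x = β), siteSq v x := by
    intro β
    rw [hG]
    simp only
    rw [Finset.sum_comm]
    exact Finset.sum_congr rfl fun x _ => sum_sq_gtrT_eq hT v x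
  -- termwise bound per (block, component)
  have hterm : ∀ β i, -(wB β ^ 2 * (Real.exp (Θ β) - 1) * nB β * G β i) ≤
      gMean blk W T (expW φ v) (β, i) * gMean blk W T (expW (fun x => -φ x) v) (β, i) -
        gMean blk W T v (β, i) ^ 2 := by
    intro β i
    set Λ := Real.exp (Θ β) - 1 with hΛ
    have hΛ0 : 0 ≤ Λ := by linarith [Real.one_le_exp_iff.mpr (hΘ β)]
    set s := univ.filter (fun x => blk x = β) with hs
    set h : St → ℝ := fun x => W x * gtrT T v x i with hh
    rw [gMean_expW, gMean_expW, gMean_eq_sum_gtrT]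
    set X := ∑ x ∈ s, ∑ x' ∈ s, (Real.exp (φ x) * Real.exp (-φ x') - 1) * (h x * h x') with hX
    have e : (∑ x ∈ s, Real.exp (φ x) * h x) * (∑ x ∈ s, Real.exp (-φ x) * h x) - (∑ x ∈ s, h x) ^ 2 = X := by
      rw [hX, sq, Finset.sum_mul_sum, Finset.sum_mul_sum, ← Finset.sum_sub_distrib]
      refine Finset.sum_congr rfl fun x _ => ?_
      rw [← Finset.sum_sub_distrib]
      exact Finset.sum_congr rfl fun x' _ => by ring
    rw [e]
    have hosc' : ∀ x ∈ s, ∀ x' ∈ s, |Real.exp (φ x) * Real.exp (-φ x') - 1| ≤ Λ := by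
      intro x hx x' hx'
      rw [← Real.exp_add, ← sub_eq_add_neg]
      have hbx : blk x = β := (mem_filter.mp hx).2
      have := hosc x x' (hbx.trans ((mem_filter.mp hx').2).symm)
      rw [hbx] at this
      exact abs_exp_sub_one_le this
    have hXle : |X| ≤ Λ * (∑ x ∈ s, |h x|) ^ 2 := by
      calc |X| ≤ ∑ x ∈ s, |∑ x' ∈ s, (Real.exp (φ x) * Real.exp (-φ x') - 1) * (h x * h x')| :=
            Finset.abs_sum_le_sum_abs _ _
        _ ≤ ∑ x ∈ s, ∑ x' ∈ s, |(Real.exp (φ x) * Real.exp (-φ x') - 1) * (h x * h x')| :=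
            Finset.sum_le_sum fun x _ => Finset.abs_sum_le_sum_abs _ _
        _ ≤ ∑ x ∈ s, ∑ x' ∈ s, Λ * (|h x| * |h x'|) := by
            refine Finset.sum_le_sum fun x hx => Finset.sum_le_sum fun x' hx' => ?_
            rw [abs_mul, abs_mul (h x)]
            exact mul_le_mul_of_nonneg_right (hosc' x hx x' hx') (mul_nonneg (abs_nonneg _) (abs_nonneg _))
        _ = Λ * (∑ x ∈ s, |h x|) ^ 2 := by
            rw [sq, Finset.sum_mul_sum, Finset.mul_sum]
            refine Finset.sum_congr rfl fun x _ => ?_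
            rw [Finset.mul_sum]
    have hh2 : ∀ x ∈ s, |h x| ^ 2 ≤ wB β ^ 2 * gtrT T v x i ^ 2 := fun x hx => by
      rw [hh]
      simp only
      rw [abs_mul, mul_pow, sq_abs (gtrT T v x i)]
      have hbx : blk x = β := (mem_filter.mp hx).2
      have hWx := hW x
      rw [hbx] at hWx
      exact mul_le_mul_of_nonneg_right (pow_le_pow_left₀ (abs_nonneg _) hWx 2) (sq_nonneg _)
    have hcs : (∑ x ∈ s, |h x|) ^ 2 ≤ nB β * (wB β ^ 2 * G β i) := by
      calc (∑ x ∈ s, |h x|) ^ 2 ≤ s.card * ∑ x ∈ s, |h x| ^ 2 := sq_sum_le_card_mul_sum_sq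
        _ ≤ s.card * ∑ x ∈ s, wB β ^ 2 * gtrT T v x i ^ 2 :=
            mul_le_mul_of_nonneg_left (Finset.sum_le_sum fun x hx => hh2 x hx) (Nat.cast_nonneg _)
        _ = s.card * (wB β ^ 2 * G β i) := by rw [hG, ← Finset.mul_sum]
        _ ≤ nB β * (wB β ^ 2 * G β i) :=
            mul_le_mul_of_nonneg_right (by exact_mod_cast hn β) (mul_nonneg (sq_nonneg _) (hG0 β i))
    have hX' : |X| ≤ Λ * (nB β * (wB β ^ 2 * G β i)) := hXle.trans (mul_le_mul_of_nonneg_left hcs hΛ0)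
    have h1 : -(Λ * (nB β * (wB β ^ 2 * G β i))) ≤ X := (neg_le_neg hX').trans (neg_abs_le X)
    calc -(wB β ^ 2 * Λ * nB β * G β i) = -(Λ * (nB β * (wB β ^ 2 * G β i))) := by ring
      _ ≤ X := h1
  -- sum of the termwise bounds
  calc -(∑ β, wB β ^ 2 * (Real.exp (Θ β) - 1) * nB β * ∑ x ∈ univ.filter (fun x => blk x = β), siteSq v x)
      = ∑ β, ∑ i, -(wB β ^ 2 * (Real.exp (Θ β) - 1) * nB β * G β i) := by
        rw [← Finset.sum_neg_distrib]
        refine Finset.sum_congr rfl fun β _ => ?_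
        rw [← hGsum β, Finset.mul_sum, ← Finset.sum_neg_distrib]
    _ ≤ ∑ β, ∑ i, (gMean blk W T (expW φ v) (β, i) * gMean blk W T (expW (fun x => -φ x) v) (β, i) -
          gMean blk W T v (β, i) ^ 2) :=
        Finset.sum_le_sum fun β _ => Finset.sum_le_sum fun i _ => hterm β i
    _ = _ := by
        rw [← Finset.sum_sub_distrib, Fintype.sum_prod_type]

end QPart

/-! ## §3 The assembly for the multi-region operator; the conjugated-form identity -/

section Assembly

variable {St Bd B Cp J : Type} [Fintype St] [DecidableEq St] [Fintype Bd] [Fintype B] [DecidableEq B] [Fintype Cp]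
  [DecidableEq Cp] [Fintype J] (src tgt : Bd → St) (c : Bd → ℝ) (Rm : Bd → Cp → Cp → ℝ)
  (blk : J → St → B) (W : J → St → ℝ) (T : J → St → Cp → Cp → ℝ) (a : J → ℝ)

/-- **THE SITEWISE CONJUGATION-ERROR BUDGET OF `levelOp` (MODEL).**  Isometric bond matrices and level transports, `a ≥ 0`,
weight bounds `|W_j(x)| ≤ w_j(blk_j x)`, block sizes `≤ n_j(β)`, a site weight `φ` with bondwise steps `≤ θ_b` and blockwise
oscillations `≤ Θ_j(β)`:  `ERR_φ(Δ_U + Σ_j a_jG_jᵀG_j; v) ≥ −[Σ_b ½c_b²(e^{θ_b} − 1)(F(b₊) + F(b₋)) +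
Σ_j a_j Σ_β w_j(β)²(e^{Θ_j(β)} − 1)n_j(β)Σ_{x∈β}F(x)]`. [cite: Balaban1985BackgroundPropagators, (3.24) p.394 + Thm 3.1 (3.42) p.397] -/
theorem conjErr_levelOp_ge_local (hRm : ∀ b i j, ∑ k, Rm b k i * Rm b k j = if i = j then (1 : ℝ) else 0)
    (hT : ∀ j x i i', ∑ k, T j x k i * T j x k i' = if i = i' then (1 : ℝ) else 0) (ha : ∀ j, 0 ≤ a j)
    (wB : J → B → ℝ) (hW : ∀ j x, |W j x| ≤ wB j (blk j x)) (nB : J → B → ℕ)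
    (hn : ∀ j β, (univ.filter fun x => blk j x = β).card ≤ nB j β) (φ : St → ℝ) (θ : Bd → ℝ)
    (hφ : ∀ b, |φ (tgt b) - φ (src b)| ≤ θ b) (Θ : J → B → ℝ) (hΘ : ∀ j β, 0 ≤ Θ j β)
    (hosc : ∀ j x x', blk j x = blk j x' → |φ x - φ x'| ≤ Θ j (blk j x)) (v : St × Cp → ℝ) :
    -(∑ b, c b ^ 2 * (Real.exp (θ b) - 1) / 2 * (siteSq v (tgt b) + siteSq v (src b)) +
        ∑ j, a j * ∑ β, wB j β ^ 2 * (Real.exp (Θ j β) - 1) * nB j β *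
          ∑ x ∈ univ.filter (fun x => blk j x = β), siteSq v x) ≤
      conjErr (levelOp src tgt c Rm blk W T a) φ v := by
  unfold conjErr
  rw [bilin_levelOp, bilin_levelOp]
  have hd := dPart_ge_local c Rm hRm φ θ hφ v
  have hsq : ∑ q, covD src tgt c Rm v q * covD src tgt c Rm v q = ∑ q, covD src tgt c Rm v q ^ 2 :=
    Finset.sum_congr rfl fun q _ => (sq _).symm
  have hq : ∀ j, -(∑ β, wB j β ^ 2 * (Real.exp (Θ j β) - 1) * nB j β *
      ∑ x ∈ univ.filter (fun x => blk j x = β), siteSq v x) ≤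
      ∑ q, gMean (blk j) (W j) (T j) (expW φ v) q * gMean (blk j) (W j) (T j) (expW (fun x => -φ x) v) q -
        ∑ q, gMean (blk j) (W j) (T j) v q * gMean (blk j) (W j) (T j) v q := by
    intro j
    have h := qPart_gMean_ge_local (blk j) (wB j) (hW j) (hT j) (nB j) (hn j) (Θ j) (hΘ j) φ (hosc j) v
    have e : ∑ q, gMean (blk j) (W j) (T j) v q * gMean (blk j) (W j) (T j) v q =
        ∑ q, gMean (blk j) (W j) (T j) v q ^ 2 := Finset.sum_congr rfl fun q _ => (sq _).symm
    rw [e]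
    exact h
  -- combine
  have hlev : -(∑ j, a j * ∑ β, wB j β ^ 2 * (Real.exp (Θ j β) - 1) * nB j β *
      ∑ x ∈ univ.filter (fun x => blk j x = β), siteSq v x) ≤
      ∑ j, a j * ∑ q, gMean (blk j) (W j) (T j) (expW φ v) q * gMean (blk j) (W j) (T j) (expW (fun x => -φ x) v) q -
        ∑ j, a j * ∑ q, gMean (blk j) (W j) (T j) v q * gMean (blk j) (W j) (T j) v q := by
    rw [← Finset.sum_sub_distrib, ← Finset.sum_neg_distrib]
    refine Finset.sum_le_sum fun j _ => ?_
    rw [← mul_sub, ← mul_neg]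
    exact mul_le_mul_of_nonneg_left (hq j) (ha j)
  rw [hsq] at *
  linarith

omit [DecidableEq St] [Fintype Bd] [Fintype B] [DecidableEq B] [DecidableEq Cp] [Fintype J] in
/-- **The conjugated-form identity**: `Σ_p (e^{φ}v)(p)·(A(e^{−φ}v))(p) = ⟨v, Av⟩ + ERR_φ(A; v)` — the left side is the
hypothesis shape of `MultiscaleCombesThomasBudget.norm_cmat_inv_apply_le_local` (with `φ = κ·d(·, j)`). [folklore] -/
theorem conjForm_eq (A : Module.End ℝ (St × Cp → ℝ)) (φ : St → ℝ) (v : St × Cp → ℝ) :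
    ∑ p, expW φ v p * A (expW (fun x => -φ x) v) p = ∑ p, v p * A v p + conjErr A φ v := by
  unfold conjErr
  ring

end Assembly

/-! ## §4 (v1.1, GEN 8) The SECOND-ORDER bondwise budget: `cosh θ_b − 1` in place of `(e^{θ_b} − 1)/2`

§1's budget `(e^{θ_b} − 1)/2` is FIRST order in the step `θ_b`; with the scale-adapted step `θ_b = κ/n` of node (w2′) it costs
`≍ c²κ/n` per site against a local coercivity `≍ κ₀/n²` — not level-free.  The bond identity `bond_term` is in fact second
order: `e^t + e^{−t} − 2 = 2(cosh t − 1) ≤ 2(cosh θ − 1) ≤ 2θ²` (`|t| ≤ θ ≤ 1`), which costs `≍ c²κ²/n²` — the same local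
scale as the coercivity (the owner's `MultiscaleCombesThomasBudget.ctWeight_le_sq_of_abs_sub_le` is the matrix-currency twin). -/

section Cosh

variable {St Bd Cp : Type} [Fintype St] [DecidableEq St] [Fintype Bd] [Fintype Cp] [DecidableEq Cp]
  {src tgt : Bd → St} (c : Bd → ℝ) (Rm : Bd → Cp → Cp → ℝ)

omit [Fintype St] [DecidableEq St] [Fintype Bd] [Fintype Cp] [DecidableEq Cp] in
/-- `|t| ≤ θ ⟹ e^t + e^{−t} − 2 ≤ 2(cosh θ − 1)` (`cosh` is even and monotone on `[0, ∞)`: Mathlib `Real.cosh_le_cosh`).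
[folklore] -/
theorem exp_add_exp_neg_sub_two_le_cosh {t θ : ℝ} (ht : |t| ≤ θ) :
    Real.exp t + Real.exp (-t) - 2 ≤ 2 * (Real.cosh θ - 1) := by
  have h : Real.cosh t ≤ Real.cosh θ := Real.cosh_le_cosh.mpr (ht.trans (le_abs_self θ))
  rw [Real.cosh_eq t] at h
  linarith

omit [Fintype St] [DecidableEq St] in
/-- **The ∇_U-part of the conjugation error with a BONDWISE SECOND-ORDER budget** (isometric bond matrices;
`|φ(b₊) − φ(b₋)| ≤ θ_b`): `Σ_q (∇_U e^{φ}v)(q)(∇_U e^{−φ}v)(q) − Σ_q ((∇_U v)(q))² ≥ −Σ_b c_b²·(cosh θ_b − 1)·(F(b₊) + F(b₋))`.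
[cite: Balaban1985BackgroundPropagators, Thm 3.1 (3.42) p.397] -/
theorem dPart_ge_local_cosh (hRm : ∀ b i j, ∑ k, Rm b k i * Rm b k j = if i = j then (1 : ℝ) else 0)
    (φ : St → ℝ) (θ : Bd → ℝ) (hφ : ∀ b, |φ (tgt b) - φ (src b)| ≤ θ b) (v : St × Cp → ℝ) :
    -(∑ b, c b ^ 2 * (Real.cosh (θ b) - 1) * (siteSq v (tgt b) + siteSq v (src b))) ≤
      ∑ q, covD src tgt c Rm (expW φ v) q * covD src tgt c Rm (expW (fun x => -φ x) v) q -
        ∑ q, covD src tgt c Rm v q ^ 2 := by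
  have hch : ∀ t : ℝ, 0 ≤ Real.exp t + Real.exp (-t) - 2 := fun t => by
    have h := Real.one_le_cosh t
    rw [Real.cosh_eq] at h
    linarith
  -- the termwise majorant
  set tb : Bd × Cp → ℝ := fun q => -(c q.1 ^ 2 * (2 * (Real.cosh (θ q.1) - 1)) *
    (((∑ j, Rm q.1 q.2 j * v (tgt q.1, j)) ^ 2 + v (src q.1, q.2) ^ 2) / 2)) with htb
  have hterm : ∀ q : Bd × Cp, tb q ≤
      covD src tgt c Rm (expW φ v) q * covD src tgt c Rm (expW (fun x => -φ x) v) q - covD src tgt c Rm v q ^ 2 := by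
    intro q
    rw [htb, bond_term]
    refine neg_mul_mul_ge (mul_nonneg (sq_nonneg _) (hch _)) ?_
    exact mul_le_mul_of_nonneg_left (exp_add_exp_neg_sub_two_le_cosh (hφ q.1)) (sq_nonneg _)
  -- sum over the components of each bond: isometry of Rm
  have hbond : ∀ b : Bd, ∑ k, tb (b, k) = -(c b ^ 2 * (Real.cosh (θ b) - 1) * (siteSq v (tgt b) + siteSq v (src b))) := by
    intro b
    have e : ∀ k, tb (b, k) =
        -(c b ^ 2 * (Real.cosh (θ b) - 1)) * ((∑ j, Rm b k j * v (tgt b, j)) ^ 2 + v (src b, k) ^ 2) := fun k => by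
      rw [htb]; ring
    calc ∑ k, tb (b, k) = -(c b ^ 2 * (Real.cosh (θ b) - 1)) *
          ∑ k, ((∑ j, Rm b k j * v (tgt b, j)) ^ 2 + v (src b, k) ^ 2) := by
          rw [Finset.mul_sum]
          exact Finset.sum_congr rfl fun k _ => e k
      _ = -(c b ^ 2 * (Real.cosh (θ b) - 1) * (siteSq v (tgt b) + siteSq v (src b))) := by
          rw [Finset.sum_add_distrib, sum_sq_Rm_apply Rm hRm b (fun j => v (tgt b, j))]
          unfold siteSq
          ring
  have htot : ∑ q : Bd × Cp, tb q = -(∑ b, c b ^ 2 * (Real.cosh (θ b) - 1) * (siteSq v (tgt b) + siteSq v (src b))) := by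
    rw [Fintype.sum_prod_type, ← Finset.sum_neg_distrib]
    exact Finset.sum_congr rfl fun b _ => hbond b
  rw [← htot, ← Finset.sum_sub_distrib]
  exact Finset.sum_le_sum fun q _ => hterm q

variable {B J : Type} [Fintype B] [DecidableEq B] [Fintype J] (src tgt)
  (blk : J → St → B) (W : J → St → ℝ) (T : J → St → Cp → Cp → ℝ) (a : J → ℝ)

/-- **THE SITEWISE CONJUGATION-ERROR BUDGET OF `levelOp`, SECOND-ORDER BOND PART (MODEL).**  As `conjErr_levelOp_ge_local`
with the bond term `Σ_b c_b²(cosh θ_b − 1)(F(b₊) + F(b₋))`:  `ERR_φ(Δ_U + Σ_j a_jG_jᵀG_j; v) ≥ −[Σ_b c_b²(cosh θ_b − 1)(F(b₊) + F(b₋))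
+ Σ_j a_j Σ_β w_j(β)²(e^{Θ_j(β)} − 1)n_j(β)Σ_{x∈β}F(x)]` — with `θ_b = κ/n(b)` and print-size averaging weights BOTH parts live on the
local scale `n⁻²` of the coercivity. [cite: Balaban1985BackgroundPropagators, (3.24) p.394 + Thm 3.1 (3.42) p.397] -/
theorem conjErr_levelOp_ge_local_cosh (hRm : ∀ b i j, ∑ k, Rm b k i * Rm b k j = if i = j then (1 : ℝ) else 0)
    (hT : ∀ j x i i', ∑ k, T j x k i * T j x k i' = if i = i' then (1 : ℝ) else 0) (ha : ∀ j, 0 ≤ a j)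
    (wB : J → B → ℝ) (hW : ∀ j x, |W j x| ≤ wB j (blk j x)) (nB : J → B → ℕ)
    (hn : ∀ j β, (univ.filter fun x => blk j x = β).card ≤ nB j β) (φ : St → ℝ) (θ : Bd → ℝ)
    (hφ : ∀ b, |φ (tgt b) - φ (src b)| ≤ θ b) (Θ : J → B → ℝ) (hΘ : ∀ j β, 0 ≤ Θ j β)
    (hosc : ∀ j x x', blk j x = blk j x' → |φ x - φ x'| ≤ Θ j (blk j x)) (v : St × Cp → ℝ) :
    -(∑ b, c b ^ 2 * (Real.cosh (θ b) - 1) * (siteSq v (tgt b) + siteSq v (src b)) +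
        ∑ j, a j * ∑ β, wB j β ^ 2 * (Real.exp (Θ j β) - 1) * nB j β *
          ∑ x ∈ univ.filter (fun x => blk j x = β), siteSq v x) ≤
      conjErr (levelOp src tgt c Rm blk W T a) φ v := by
  unfold conjErr
  rw [bilin_levelOp, bilin_levelOp]
  have hd := dPart_ge_local_cosh c Rm hRm φ θ hφ v
  have hsq : ∑ q, covD src tgt c Rm v q * covD src tgt c Rm v q = ∑ q, covD src tgt c Rm v q ^ 2 :=
    Finset.sum_congr rfl fun q _ => (sq _).symm
  have hq : ∀ j, -(∑ β, wB j β ^ 2 * (Real.exp (Θ j β) - 1) * nB j β *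
      ∑ x ∈ univ.filter (fun x => blk j x = β), siteSq v x) ≤
      ∑ q, gMean (blk j) (W j) (T j) (expW φ v) q * gMean (blk j) (W j) (T j) (expW (fun x => -φ x) v) q -
        ∑ q, gMean (blk j) (W j) (T j) v q * gMean (blk j) (W j) (T j) v q := by
    intro j
    have h := qPart_gMean_ge_local (blk j) (wB j) (hW j) (hT j) (nB j) (hn j) (Θ j) (hΘ j) φ (hosc j) v
    have e : ∑ q, gMean (blk j) (W j) (T j) v q * gMean (blk j) (W j) (T j) v q =
        ∑ q, gMean (blk j) (W j) (T j) v q ^ 2 := Finset.sum_congr rfl fun q _ => (sq _).symm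
    rw [e]
    exact h
  have hlev : -(∑ j, a j * ∑ β, wB j β ^ 2 * (Real.exp (Θ j β) - 1) * nB j β *
      ∑ x ∈ univ.filter (fun x => blk j x = β), siteSq v x) ≤
      ∑ j, a j * ∑ q, gMean (blk j) (W j) (T j) (expW φ v) q * gMean (blk j) (W j) (T j) (expW (fun x => -φ x) v) q -
        ∑ j, a j * ∑ q, gMean (blk j) (W j) (T j) v q * gMean (blk j) (W j) (T j) v q := by
    rw [← Finset.sum_sub_distrib, ← Finset.sum_neg_distrib]
    refine Finset.sum_le_sum fun j _ => ?_
    rw [← mul_sub, ← mul_neg]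
    exact mul_le_mul_of_nonneg_left (hq j) (ha j)
  rw [hsq] at *
  linarith

end Cosh

end

end Summit.QuantumFields.BalabanUV.Beta.MultiscaleConjError
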